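import Summits.QuantumFields.YangMills.Theses.CertificationLength
import Summits.QuantumFields.YangMills.Theorems.PencilRigidityDiagonalMirrorRPRStubFortyFiveSwapRP
import Summits.QuantumFields.YangMills.Theorems.PencilRigidityDiagonalMirrorRPRStubRpClosureOffDiag

/-!
# Line `ds-mixture-two-orientations` for crux `DiagonalFramesAtCertificationScale` (stmt-QuantumFields-16180)

Strategist line (crux-strategist `cstrat-stmt-QuantumFields-16180-b1`, 2026-08-17), an ALTERNATIVE to the birth
skeleton `Lines/birth.lean`.  Card: `Lines/ds-mixture-two-orientations.md`.

Crux (D) (`Theses/CertificationLength.lean`, rank 4): along a Dobrushin–Shlosman-certified scheme (`β_k ≥ 0`, TV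
finite-size condition at `(β_k, b_k)`, `a_k = ℓ₀/b_k`, `2L_k+1 ≥ (8n+7) b_k`, `log²(|c_k|+1) ≤ a_k L_k`) whose
renormalised curvature strings converge on `⁰𝒮` (real tensors) to a normalised `S₁`, the family `S₁` is reflection
positive in pull-back form in the four diagonal frames — the landed predicate `DiagonalFrameRP S₁`.

## The cut (six named stubs, sorry-free composition)

DS half — "both periodic states are MIXTURES of the same `ℤ⁴` kernels" (no uniqueness theorem and no infinite-volume
state are needed: the certificate bounds the oscillation of ONE kernel mean over ALL exterior data, and both the cubic
torus state and the 45°-cover state are averages of that kernel mean):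

* `stub_coverDLR` (D1, M): the Wilson state of the FILS 45° cover `T̃_N` (sheared chart, `texp ρ β true`, `skewLift`)
  satisfies the local DLR equation of `ymSpecification ρ β` on every link set `Λ` which, with the observable's support
  and its collar, injects under `skewProj N` — the sheared twin of the LANDED torus identity
  `FiniteSizeCriterion.integral_torusLift_mul_eq_integral_ymSpecification_mul_of_measurable`.
* `stub_comparison_of_coverDLR` (D2, M): GIVEN D1, the TV finite-size condition at `(β, b, n, ε)` bounds the
  difference of the torus mean (side `2L+1`) and the cover mean (`N = 2L+1`) of ANY bounded measurable cylinder
  observable `A` supported in the cells of radius `R_c` by `4‖A‖∞ (2R_c+1)⁴ (εM(n))^k` as soon as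
  `b (R_c + k(2n+1) + 2) ≤ L` (LANDED engines: the torus DLR identity above and `FiniteSizeCriterion.box_influence_le`,
  read in cell units).
* `stub_countertermBound` (D3, S–M): degree-1 convergence of the strings forces `|c_k m_k| ≤ K (|c_k| + 1)`
  (translation invariance of the torus mean + Riemann sums of one Schwartz function with `∫ f ≠ 0`).
* `stub_insensitivity_of_comparison` (D4, M): D2's conclusion + D3's conclusion + `a_k = ℓ₀/b_k` + the `log²` clause
  ⇒ `CoverInsensitivityOffDiag r sch`: the strings' lattice observable at step `k` lives in `⌈R/ℓ₀⌉ + ϱ` cells,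
  `‖A_k‖∞ ≤ (C(|c_k|+1))^m ≤ C^m e^{m √(a_k L_k)}`, `k_steps ≍ a_k L_k/((2n+1)ℓ₀)`, and `e^{m√x − κ x} → 0`.

Frames half — "both ORIENTATIONS of the mirror `x₀ = x₁` at lattice level; only the mirror TYPE needs a symmetry
of the limit":

* `stub_signTypeExchange` (F1, the honest residual): the certified limit is invariant, on off-diagonal real tensors,
  under SOME isometry `P` with `P e₀ = e₀`, `P e₁ = −e₁` (e.g. the proper flip of `x₁, x₂`).  At lattice level this is
  orthant-convention independence of the based-plaquette discretisation of `tr F²` (one-link shifts of single-plane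
  plaquettes); it is the ONLY input of the line not fed by the crux's hypotheses, and it is deleted by the route-level
  restatement of (D) with the curvature channel's `W(B₄)⁺` clause (which `closes` has as `hhyp₁`).
* `stub_twoOrientationClosure` (F2, M–L): `hconv` + E0 + F1's symmetry + cover swap-RP + cover insensitivity ⇒
  `DiagonalFrameRP S₁`: canonical frames `R e₀ = ±c(e₀ − e₁)` for BOTH signs at lattice level (the landed
  `psd_canonical_offDiag` with `CurvaturePackage` unbundled to `hconv` + E0, and its mirror image for the negative
  half via swap-invariance of `texp` and the involution `swapConfig`), the other two frames by `P`.

Composition `DiagonalFramesAtCertificationScale_of` (sorry-free): D4 (D2 D1) D3 gives cover insensitivity, F1 the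
symmetry, the LANDED `stub_fortyFiveSwapRP` (FILS, `β_k ≥ 0` = first conjunct of the certificate clause) the cover
swap-RP, F2 closes; `DiagonalFramesAtCertificationScale_of` invokes the six stubs BY NAME (hypothesis form `…_of_statements`).
-/

set_option autoImplicit false

noncomputable section

namespace Summit.QuantumFields.YangMills.Cruxes.DiagonalFramesAtCertificationScale.DsMixtureTwoOrientations

open scoped SchwartzMap
open MeasureTheory Filter Topology
open Literature.MathematicalPhysics.QuantumLattice Literature.MathematicalPhysics.AQFT
  Literature.MathematicalPhysics.QuantumFieldTheory
open Summit.QuantumFields.YangMills.Cruxes.DiagonalMirrorRPR.ParityBridgeColdTraces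

/-! ## §0 Vocabulary: the clauses of the crux, verbatim (as in `Lines/birth.lean`) -/

section Clauses

variable {G : Type} [Group G] [TopologicalSpace G] [IsTopologicalGroup G] [CompactSpace G]
  [MeasurableSpace G] [BorelSpace G]

/-- The Dobrushin–Shlosman total-variation finite-size condition at `(ρ, β, b, n, ε)` — VERBATIM the clause of the
crux. [folklore] -/
def TVFiniteSize {N : ℕ} (ρ : G →* Matrix (Fin N) (Fin N) ℂ) (β : ℝ) (b n : ℕ) (ε : ℝ) : Prop :=
  ∀ w : Fin 4 → ℤ → ℤ, (∀ i j, w i j + ((b : ℕ) : ℤ) ≤ w i (j + 1) ∧ w i (j + 1) ≤ w i j + 2 * ((b : ℕ) : ℤ)) → ∀ Y : Finset (Fin 4 → ℤ), Y ⊆ (Fintype.piFinset fun _ : Fin 4 => Finset.Icc (-(2 * ((n : ℕ) : ℤ))) (2 * ((n : ℕ) : ℤ))) → (0 : Fin 4 → ℤ) ∈ Y → ∀ η η' : LGConfig 4 G, (∀ e ∈ (Fintype.piFinset fun _ : Fin 4 => Finset.Icc (-(2 * ((n : ℕ) : ℤ))) (2 * ((n : ℕ) : ℤ))).biUnion (fun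 y : Fin 4 → ℤ => (Fintype.piFinset fun i : Fin 4 => Finset.Ico (w i (y i)) (w i (y i + 1))) ×ˢ (Finset.univ : Finset (Fin 4))), η e = η' e) → ∀ f : LGConfig 4 G → ℝ, IsCylinder f ((fun y : Fin 4 → ℤ => (Fintype.piFinset fun i : Fin 4 => Finset.Ico (w i (y i)) (w i (y i + 1))) ×ˢ (Finset.univ : Finset (Fin 4))) 0) → Measurable f → (∀ U, 0 ≤ f U ∧ f U ≤ 1) → |(∫ U, f U ∂(ymSpecification ρ β (Y.biUnion (fun y : Fin 4 → ℤ => (Fintype.piFinset fun i : Fin 4 => Finset.Ico (w i (y i)) (w i (y i + 1))) ×ˢ (Finset.univ : Finset (Fin 4)))) η)) - ∫ U, f U ∂(ymSpecification ρ β (Y.biUnion (fun y : Fin 4 → ℤ => (Fintype.piFinset fun i : Fin 4 => Finset.Ico (w i (y i)) (w i (y i + 1))) ×ˢ (Finset.univ : Finset (Fin 4)))) η')| ≤ ε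

/-- Convergence of the renormalised curvature strings along `sch` to `S₁` on `⁰𝒮` (real tensors) — VERBATIM the
`hconv` clause of the crux. [folklore] -/
def CurvatureStringsConverge (r : LatticeRep G) (sch : SpeciesScheme (YMSpecies G)) (S₁ : SchwingerFamily E4) :
    Prop :=
  ∀ (n : ℕ), n ≠ 0 → ∀ (f : Fin n → 𝓢(E4, ℝ)) (F : 𝓢((Fin n → E4), ℂ)),
    IsTensorOf F (fun i => ofRealTest (f i)) → IsOffDiagonal F →
      Tendsto (fun k : ℕ => ((latticeSchwinger r.ρ sch (fun s => s.F) k n (fun _ => r.curvature) f : ℝ) : ℂ))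
        atTop (𝓝 (S₁ n F))

end Clauses

/-- Invariance of `S₁` on off-diagonal REAL TENSORS under SOME isometry exchanging the two diagonal mirror types
(`P e₀ = e₀`, `P e₁ = −e₁`; e.g. the proper flip of `x₁, x₂`). [folklore] -/
def SignTypeExchange (S₁ : SchwingerFamily E4) : Prop :=
  ∃ P : E4 ≃ₗᵢ[ℝ] E4, P (EuclideanSpace.single 0 1) = EuclideanSpace.single 0 1 ∧
    P (EuclideanSpace.single 1 1) = -EuclideanSpace.single 1 1 ∧
    ∀ (m : ℕ) (f : Fin m → 𝓢(E4, ℝ)) (F : 𝓢((Fin m → E4), ℂ)),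
      IsTensorOf F (fun i => ofRealTest (f i)) → IsOffDiagonal F → S₁ m (linActMulti P F) = S₁ m F

/-! ## §1 The six stub statements -/

/-- D1 — the FILS 45° cover is Gibbs for the `ℤ⁴` Wilson specification on injecting link sets (local DLR equation,
far factor `1`). -/
def CoverDLR : Prop :=
  ∀ (G : Type) [Group G] [TopologicalSpace G] [IsTopologicalGroup G] [CompactSpace G] [MeasurableSpace G]
    [BorelSpace G] [SecondCountableTopology G] (Nc : ℕ) (ρ : G →* Matrix (Fin Nc) (Fin Nc) ℂ), Continuous ρ →
    ∀ (β : ℝ) (N : ℕ) [NeZero N] (Λ : Finset (Literature.MathematicalPhysics.QuantumLattice.ZdEdge 4))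
      (F : LGConfig 4 G → ℝ) (C : ℝ) (S₀ : Finset (Literature.MathematicalPhysics.QuantumLattice.ZdEdge 4)),
      Measurable F → (∀ U, |F U| ≤ C) → IsCylinder F S₀ →
      Set.InjOn (skewProj N)
        ((Λ ∪ S₀ ∪ (plaquettesTouching Λ).biUnion plaquetteEdges).image Prod.fst : Set (Fin 4 → ℤ)) →
        texp ρ β true (fun U : TConfig (2 * N) N N G => ((F (skewLift N U) : ℝ) : ℂ)) =
          texp ρ β true (fun U : TConfig (2 * N) N N G =>
            ((∫ V, F V ∂(ymSpecification ρ β Λ (skewLift N U)) : ℝ) : ℂ))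

/-- D2 — torus mean vs cover mean of a cell-supported observable under the TV finite-size condition (both states are
mixtures of the kernel `γ_Λ`, `Λ` = the box of cells of radius `R_c + k(2n+1)`, whose mean oscillates by at most
`2‖A‖∞ (2R_c+1)⁴ (εM(n))^k` over all exterior data). -/
def TorusCoverComparison : Prop :=
  ∀ (G : Type) [Group G] [TopologicalSpace G] [IsTopologicalGroup G] [CompactSpace G] [MeasurableSpace G]
    [BorelSpace G] [SecondCountableTopology G] [T2Space G] (Nc : ℕ) (ρ : G →* Matrix (Fin Nc) (Fin Nc) ℂ),
    Continuous ρ → ∀ (β : ℝ) (b n : ℕ) (ε : ℝ), 1 ≤ n → 0 ≤ ε → 1 ≤ b → TVFiniteSize ρ β b n ε →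
    ∀ (Rc k L : ℕ), b * (Rc + k * (2 * n + 1) + 2) ≤ L →
    ∀ (A : LGConfig 4 G → ℝ) (CA : ℝ) (SA : Finset (Literature.MathematicalPhysics.QuantumLattice.ZdEdge 4)),
      Measurable A → (∀ U, |A U| ≤ CA) → IsCylinder A SA → (∀ e ∈ SA, ∀ i, |e.1 i| ≤ (b : ℤ) * Rc) →
      |(∫ U, A (torusLift (2 * L + 1) U) ∂(wilsonMeasure (d := 4) (L := 2 * L + 1) ρ β)) -
          (texp ρ β true (fun U : TConfig (2 * (2 * L + 1)) (2 * L + 1) (2 * L + 1) G =>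
            ((A (skewLift (2 * L + 1) U) : ℝ) : ℂ))).re| ≤
        4 * CA * ((2 * (Rc : ℝ) + 1) ^ 4 * (ε * ((((4 * n + 3) ^ 4 - (4 * n + 1) ^ 4 : ℕ)) : ℝ)) ^ k)

/-- D3 — the counterterm bound from degree-1 convergence. -/
def CountertermBound : Prop :=
  ∀ (G : Type) [Group G] [TopologicalSpace G] [IsTopologicalGroup G] [CompactSpace G] [MeasurableSpace G]
    [BorelSpace G] (r : LatticeRep G) (sch : SpeciesScheme (YMSpecies G)) (S₁ : SchwingerFamily E4),
    CurvatureStringsConverge r sch S₁ →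
      ∃ K : ℝ, ∀ k, |sch.c r.curvature k * sch.m r.curvature k| ≤ K * (|sch.c r.curvature k| + 1)

/-- D4's conclusion (= statement S1 of `Lines/birth.lean`): cover insensitivity of a certified scheme. -/
def InsensitivityOfCertificate : Prop :=
  ∀ (G : Type) [Group G] [TopologicalSpace G] [IsTopologicalGroup G] [CompactSpace G] [MeasurableSpace G]
    [BorelSpace G], IsCompactSimpleLieGroup G →
    ∀ (r : LatticeRep G) (n : ℕ) (ε : ℝ), 1 ≤ n → 0 ≤ ε →
      ε * ((((4 * n + 3) ^ 4 - (4 * n + 1) ^ 4 : ℕ)) : ℝ) < 1 →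
      ∀ (ℓ₀ : ℝ) (bseq : ℕ → ℕ) (sch : SpeciesScheme (YMSpecies G)) (S₁ : SchwingerFamily E4), 0 < ℓ₀ →
        (∀ k, 0 ≤ sch.β k ∧ 1 ≤ bseq k ∧ TVFiniteSize r.ρ (sch.β k) (bseq k) n ε) →
        (∀ k, sch.a k = ℓ₀ / (bseq k : ℝ)) →
        (∀ k, (8 * n + 7) * bseq k ≤ 2 * sch.L k + 1 ∧
          Real.log (|sch.c r.curvature k| + 1) ^ 2 ≤ sch.a k * sch.L k) →
        CurvatureStringsConverge r sch S₁ →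
          CoverInsensitivityOffDiag r sch

/-- F1 — the residual: sign-type exchange symmetry of the certified limit. -/
def SignTypeExchangeOfLimit : Prop :=
  ∀ (G : Type) [Group G] [TopologicalSpace G] [IsTopologicalGroup G] [CompactSpace G] [MeasurableSpace G]
    [BorelSpace G], IsCompactSimpleLieGroup G →
    ∀ (r : LatticeRep G) (n : ℕ) (ε : ℝ), 1 ≤ n → 0 ≤ ε →
      ε * ((((4 * n + 3) ^ 4 - (4 * n + 1) ^ 4 : ℕ)) : ℝ) < 1 →
      ∀ (ℓ₀ : ℝ) (bseq : ℕ → ℕ) (sch : SpeciesScheme (YMSpecies G)) (S₁ : SchwingerFamily E4), 0 < ℓ₀ →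
        (∀ k, 0 ≤ sch.β k ∧ 1 ≤ bseq k ∧ TVFiniteSize r.ρ (sch.β k) (bseq k) n ε) →
        (∀ k, sch.a k = ℓ₀ / (bseq k : ℝ)) →
        (∀ k, (8 * n + 7) * bseq k ≤ 2 * sch.L k + 1 ∧
          Real.log (|sch.c r.curvature k| + 1) ^ 2 ≤ sch.a k * sch.L k) →
        CurvatureStringsConverge r sch S₁ →
          SignTypeExchange S₁

/-- F2 — the closure in the four diagonal frames from both ORIENTATIONS of the swap mirror at lattice level and one
sign-type exchange of the limit. -/
def TwoOrientationClosure : Prop :=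
  ∀ (G : Type) [Group G] [TopologicalSpace G] [IsTopologicalGroup G] [CompactSpace G] [MeasurableSpace G]
    [BorelSpace G], IsCompactSimpleLieGroup G →
    ∀ (r : LatticeRep G) (sch : SpeciesScheme (YMSpecies G)) (S₁ : SchwingerFamily E4),
      CurvatureStringsConverge r sch S₁ → S₁.toLabelled.IsNormalized → SignTypeExchange S₁ →
        (∀ k, 2 ≤ sch.side k → CoverSwapRPAt r.ρ (sch.β k) (sch.side k)) →
          CoverInsensitivityOffDiag r sch → DiagonalFrameRP S₁

/-! ## §2 The stubs -/

/-- **D1 (M) — `stub_coverDLR`.** The 45°-cover Wilson state (`texp ρ β true` on `TConfig (2N) N N`, pulled back to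
`ℤ⁴` by `skewLift N`) satisfies the local DLR equation of `ymSpecification ρ β` on every finite link set `Λ` such
that `skewProj N` is injective on the base points of `Λ ∪ supp F ∪ ∂Λ`.  Sheared twin of the landed torus identity
(`…FiniteSizeCriterionTorus`: `integral_torusLift_mul_eq_integral_ymSpecification_mul_of_measurable`, far factor
`H = 1`): the cover weight factorises over cover plaquettes = `ℤ⁴` plaquettes mod `Λ̃_N`
(`skewProj (x + eᵢ) = skewProj x + tstep true i`), near/far split of the action, `glueWith`/`piecewise` transfer of
the fibre integrals, `integral_exp_mul_eq_integral_exp_mul_condAvg`. -/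
theorem stub_coverDLR : CoverDLR := by
  sorry

/-- **D2 (M) — `stub_comparison_of_coverDLR`.** Given D1: under the TV finite-size condition at `(β, b, n, ε)`, for a
bounded measurable cylinder observable `A` supported in the cells of radius `R_c` and `b(R_c + k(2n+1) + 2) ≤ L`,
the torus mean (side `2L+1`) and the cover mean (`N = 2L+1`) of `A` differ by at most `4‖A‖∞ (2R_c+1)⁴ (εM(n))^k`:
both are averages (torus DLR identity, landed; cover DLR identity, D1) of the kernel mean
`η ↦ γ_Λ(A | η)`, `Λ` = the box of cells of radius `R_c + k(2n+1)` (it and its collar inject into both quotients,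
width `< 2L+1`), which oscillates by at most `2‖A‖∞ (2R_c+1)⁴ (εM(n))^k` over ALL exterior data
(`FiniteSizeCriterion.box_influence_le`, read with the support hypothesis in cell units — its proof converts
`|e.1 i| ≤ R_A` to cell membership at one place). -/
theorem stub_comparison_of_coverDLR : CoverDLR → TorusCoverComparison := by
  sorry

/-- **D3 (S–M) — `stub_countertermBound`.** Degree-1 convergence of the strings (`n = 1`, one real Schwartz `f` with
`∫ f ≠ 0`) gives `|c_k m_k| ≤ K (|c_k| + 1)`: `⟨Φ̃_k(f)⟩ = c_k (e_k − m_k) · a_k⁴ ∑_{x ∈ box} f(a_k x)` with `e_k` the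
(translation-invariant) torus mean of the action density, `|e_k| ≤ ‖O‖∞`, and the Riemann sums tend to `∫ f`
(`a_k → 0`, `a_k L_k → ∞`). -/
theorem stub_countertermBound : CountertermBound := by
  sorry

/-- **D4 (M) — `stub_insensitivity_of_comparison`.** From D2 and D3: for compactly supported real `f_l` (radius `R`)
the strings' observable `A_k = ∏_l Φ̃_k(f_l)` is a cylinder function of the cells of radius `R_c = ⌈R/ℓ₀⌉ + ϱ`
(`a_k = ℓ₀/b_k`; `ϱ` = radius of the curvature observable), `‖A_k‖∞ ≤ (C_f (2‖O‖∞|c_k| + K))^m`, and with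
`k_steps = ⌊(L_k/b_k − R_c − 2)/(2n+1)⌋ ≍ a_k L_k/((2n+1)ℓ₀) → ∞` the bound of D2 tends to `0` because
`log(|c_k|+1) ≤ √(a_k L_k)` and `e^{m√x − κx} → 0`; `latticeSchwinger`/`coverSchwinger` ARE the torus/cover means of
`A_k` by definition.  Hence `CoverInsensitivityOffDiag r sch`. -/
theorem stub_insensitivity_of_comparison :
    TorusCoverComparison → CountertermBound → InsensitivityOfCertificate := by
  sorry

/-- **F1 (the residual) — `stub_signTypeExchange`.** Along a certified convergent scheme the limit `S₁` is
invariant on off-diagonal real tensors under some isometry `P` with `P e₀ = e₀`, `P e₁ = −e₁`.  Lattice meaning: the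
torus measure is invariant under the flip `(x₁, x₂) ↦ (−x₁, −x₂)`, under which the based-plaquette discretisation of
`tr F²` is covariant up to one-link shifts of the plaquettes in the planes containing a flipped axis, so the claim is
that these `O(a_k)` single-plane shift artefacts vanish in renormalised correlations in the limit (orthant-convention
independence).  NOT fed by the crux's hypotheses (they control only the summed six-plane strings); physically
`O(a_k log^p) → 0`; the exact lattice symmetries of the based observable are `S₄ ⋉ ℤ⁴` only, so no line for (D) as
typed avoids an input of this kind.  Deleted by restating (D) with the `W(B₄)⁺` clause of the curvature channel
(`closes` has it as `hhyp₁`). -/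
theorem stub_signTypeExchange : SignTypeExchangeOfLimit := by
  sorry

/-- **F2 (M–L) — `stub_twoOrientationClosure`.** `hconv` + E0 + sign-type exchange + cover swap-RP at every `k`
with `N_k ≥ 2` + cover insensitivity on disjoint compact real families ⇒ `DiagonalFrameRP S₁`.  Frames
`R e₀ = c(e₀ − e₁)`, `c > 0`: the landed `RpClosure.psd_canonical_offDiag` / `isReflectionPositive_pullback_offDiag`
with `CurvaturePackage` unbundled (their proofs destructure only `hconv` and E0).  Frames `c < 0` (same mirror,
opposite orientation): the same argument with observables eventually in the NEGATIVE half `N ≤ u ≤ 2N`, whose Gram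
matrix `⟨(A_I ∘ θ^*) A_J⟩` is that of the swapped family `A_I ∘ θ^*` (positive half) by `θ^* ∘ θ^* = id` and
`θ^*`-invariance of `texp ρ β true` — so `lattice_psd` applies; equivalently smear against `h ∘ swap₀₁`
(`smearedLatticeField_swap`).  Frames `R e₀ = ±c(e₀ + e₁)`: `(R.trans P) e₀ = ±c(e₀ − e₁)` for the `P` of
`SignTypeExchange`, and `𝔖(PR·G) = 𝔖(R·G)` on the off-diagonal real tensors `G = Θ P_I* ⊗ P_J`. -/
theorem stub_twoOrientationClosure : TwoOrientationClosure := by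
  sorry

/-- The stubs inhabit the named statements (term-level readback). -/
example : CoverDLR ∧ (CoverDLR → TorusCoverComparison) ∧ CountertermBound ∧
    (TorusCoverComparison → CountertermBound → InsensitivityOfCertificate) ∧
    SignTypeExchangeOfLimit ∧ TwoOrientationClosure :=
  ⟨stub_coverDLR, stub_comparison_of_coverDLR, stub_countertermBound, stub_insensitivity_of_comparison,
    stub_signTypeExchange, stub_twoOrientationClosure⟩

/-! ## §3 The composition (sorry-free) -/

/-- **Composition, registered form (the skeleton of record)** — the crux decl BY NAME from the six stubs BY NAME:
D4 (D2 D1) D3 gives cover insensitivity, F1 the sign-type exchange, the LANDED `stub_fortyFiveSwapRP` (FILS, `β_k ≥ 0` =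
first conjunct of the certificate clause, `N_k ≥ 2`) the cover swap-RP, F2 closes.  No `sorry` here (closed modulo the
`sorryAx` of `stub_*` only). -/
theorem DiagonalFramesAtCertificationScale_of :
    Summit.QuantumFields.YangMills.Theses.CertificationLength.DiagonalFramesAtCertificationScale := by
  intro G _ _ _ _ hG
  letI : MeasurableSpace G := borel G
  haveI : BorelSpace G := ⟨rfl⟩
  intro r n ε hn hε hM ℓ₀ bseq sch S₁ hℓ hcert ha hL hconv hE0
  -- DS half: cover insensitivity of the certified scheme (kernel-mixture comparison torus ↔ cover)
  have hCI : CoverInsensitivityOffDiag r sch :=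
    stub_insensitivity_of_comparison (stub_comparison_of_coverDLR stub_coverDLR) stub_countertermBound G hG r n ε
      hn hε hM ℓ₀ bseq sch S₁ hℓ hcert ha hL hconv
  -- the residual symmetry of the limit (sign-type exchange)
  have hP : SignTypeExchange S₁ := stub_signTypeExchange G hG r n ε hn hε hM ℓ₀ bseq sch S₁ hℓ hcert ha hL hconv
  -- LANDED (FILS 1978 Thm 2.1 on the tilted torus): swap-RP of Wilson's measure on `T̃_{N_k}`, `β_k ≥ 0`, `N_k ≥ 2`
  have hRP : ∀ k, 2 ≤ sch.side k → CoverSwapRPAt r.ρ (sch.β k) (sch.side k) := fun k hk =>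
    stub_fortyFiveSwapRP G r.N r.ρ r.continuous r.mem_unitary (sch.β k) (hcert k).1 (sch.side k) hk
  -- frames half: both orientations of `x₀ = x₁` upstairs, the mirror `x₀ = −x₁` through `P`
  exact stub_twoOrientationClosure G hG r sch S₁ hconv hE0 hP hRP hCI

/-- **Composition, hypothesis form** — D1 → (D1 → D2) → D3 → (D2 → D3 → D4) → F1 → F2 → the crux BY NAME, over the six
NAMED statements (the same twelve lines with the stubs abstracted; no `sorry`). -/
theorem DiagonalFramesAtCertificationScale_of_statements :
    CoverDLR → (CoverDLR → TorusCoverComparison) → CountertermBound →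
      (TorusCoverComparison → CountertermBound → InsensitivityOfCertificate) →
      SignTypeExchangeOfLimit → TwoOrientationClosure →
        Summit.QuantumFields.YangMills.Theses.CertificationLength.DiagonalFramesAtCertificationScale := by
  intro h1 h2 h3 h4 h5 h6 G _ _ _ _ hG
  letI : MeasurableSpace G := borel G
  haveI : BorelSpace G := ⟨rfl⟩
  intro r n ε hn hε hM ℓ₀ bseq sch S₁ hℓ hcert ha hL hconv hE0
  have hCI : CoverInsensitivityOffDiag r sch :=
    h4 (h2 h1) h3 G hG r n ε hn hε hM ℓ₀ bseq sch S₁ hℓ hcert ha hL hconv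
  have hP : SignTypeExchange S₁ := h5 G hG r n ε hn hε hM ℓ₀ bseq sch S₁ hℓ hcert ha hL hconv
  have hRP : ∀ k, 2 ≤ sch.side k → CoverSwapRPAt r.ρ (sch.β k) (sch.side k) := fun k hk =>
    stub_fortyFiveSwapRP G r.N r.ρ r.continuous r.mem_unitary (sch.β k) (hcert k).1 (sch.side k) hk
  exact h6 G hG r sch S₁ hconv hE0 hP hRP hCI

/-- The registered form is the hypothesis form with the stubs plugged in by name (definitional readback). -/
example : Summit.QuantumFields.YangMills.Theses.CertificationLength.DiagonalFramesAtCertificationScale :=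
  DiagonalFramesAtCertificationScale_of_statements stub_coverDLR stub_comparison_of_coverDLR stub_countertermBound
    stub_insensitivity_of_comparison stub_signTypeExchange stub_twoOrientationClosure

/-! ## §4 Readbacks (kernel-checked `Iff.rfl`s): the line's vocabulary IS the crux's / the landed one -/

/-- The crux's conclusion is the landed `DiagonalFrameRP`, its convergence clause is `CurvatureStringsConverge`, and
the strings at step `k` ARE the torus / cover means of one and the same `ℤ⁴` observable (the product of smeared
fields), as D2/D4 use them. -/
example {G : Type} [Group G] [TopologicalSpace G] [IsTopologicalGroup G] [CompactSpace G]
    (r : @LatticeRep G _ _) (sch : SpeciesScheme (@YMSpecies G _ (borel G)))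
    (S₁ : SchwingerFamily E4) (k m : ℕ) (f : Fin m → 𝓢(E4, ℝ)) :
    letI : MeasurableSpace G := borel G
    haveI : BorelSpace G := ⟨rfl⟩
    (DiagonalFrameRP S₁ ↔
      ∀ (R : E4 ≃ₗᵢ[ℝ] E4) (a c : ℝ), a ^ 2 = 1 / 2 → c ^ 2 = 1 / 2 →
        R (EuclideanSpace.single 0 1) = a • EuclideanSpace.single 0 1 + c • EuclideanSpace.single 1 1 →
          (SchwingerFamily.toLabelled (fun m => (S₁ m).comp (linActMulti R))).IsReflectionPositive) ∧
    (latticeSchwinger r.ρ sch (fun s => s.F) k m (fun _ => r.curvature) f =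
      ∫ U, (fun W : LGConfig 4 G => ∏ i, smearedLatticeField r.curvature.F
          (Literature.Probability.LatticeModels.box 4 (sch.L k)) (sch.a k) (sch.c r.curvature k)
          (sch.m r.curvature k) (f i) W) (torusLift (sch.side k) U)
        ∂(wilsonMeasure (d := 4) (L := sch.side k) r.ρ (sch.β k))) ∧
    (coverSchwinger r sch k m f =
      (texp r.ρ (sch.β k) true fun U : TConfig (2 * sch.side k) (sch.side k) (sch.side k) G =>
        (((fun W : LGConfig 4 G => ∏ i, smearedLatticeField r.curvature.F
          (Literature.Probability.LatticeModels.box 4 (sch.L k)) (sch.a k) (sch.c r.curvature k)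
          (sch.m r.curvature k) (f i) W) (skewLift (sch.side k) U) : ℝ) : ℂ)).re) ∧
    (sch.side k = 2 * sch.L k + 1) :=
  ⟨Iff.rfl, rfl, rfl, rfl⟩

end Summit.QuantumFields.YangMills.Cruxes.DiagonalFramesAtCertificationScale.DsMixtureTwoOrientations

end
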